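import Mathlib
import Summits.RiemannHypothesis.RiemannHypothesis.Theses.RuelleBand
import Summits.RiemannHypothesis.RiemannHypothesis.Theorems.CofiniteCriticalLine.Negative.Reformulations
import Summits.RiemannHypothesis.RiemannHypothesis.Theorems.CofiniteCriticalLine.Negative.LoadBearing
import Summits.RiemannHypothesis.RiemannHypothesis.Theorems.CofiniteCriticalLine.Negative.AbstractModels
import Literature.NumberTheory.LFunctions.WeilExplicit
import Literature.NumberTheory.LFunctions.WeilMellinBounds

/-!
# Line `pontryagin-neutral-engine` for crux `CofiniteCriticalLine` (stmt-RiemannHypothesis-2064)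

Skeleton (crux-plan, round 1, gen 2) of the idea card
`Cruxes/CofiniteCriticalLine/Ideas/pontryagin-neutral-engine.md` as MERGED by the triage panel
(TRIAGE-r1-1/2/3: "fail as a standalone line — ∃-typed C⁺ is costume unless pinned; merge into
weil-inertia-pontryagin-index"): the Π_κ engine PINNED on the one form the card's census (W1)–(W4)
and the panel leave standing, Weil's quadratic functional `Q(g) = W(g ⋆ g̃)`
(`Literature.NumberTheory.LFunctions.weilQuadratic`), with the merged line's bet
`BoundedWeilIndex` (Bombieri's count made two-sided) as its single research stub.

THE LINE. `BoundedWeilIndex` (Weil's form has finitely many negative squares — THE BET, crux-strength,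
shared verbatim with the sibling cards weil-inertia-pontryagin-index / cofinite-weil-index-staircase)
⟹ the completion of (test functions ⧸ radical, `Q`) is a Pontryagin space `Π_κ` on which the
translations `τ_x g = g(· - x)` (tree `weilTranslate`) act as a strongly continuous group of
`J`-unitary operators `U_x` whose matrix coefficients are the Weil numbers `W(τ_x g ⋆ h̃)`
(`stub_weilPontryaginCompletion`)
⟹ THE ENGINE in matrix-coefficient / Laplace form (the card's eigenvector form cannot be fed here:
joint eigenvectors for expanding zeros are evaluation functionals `g ↦ ĝ(1 - ρ̄)`, whose continuity on
the completion is unknown before finiteness is — PinningCensusPontryagin.md P3): the Riesz part of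
`U_1` outside the closed unit disc is `J`-NEUTRAL, hence of dimension `≤ κ`, and its complement has
spectral radius `≤ 1` (`stub_pontryaginExpandingPart` — the ONE place finite index is used)
⟹ every Laplace transform `s ↦ ∫₀^∞ ⟪f₂, J U_x f₁⟫ e^{-sx} dx` continues analytically to
`{Re s > 0}` minus ONE finite set `Z`, `#Z ≤ κ` (`stub_laplaceContinuation`)
⟹ but by the explicit formula the DIAGONAL coefficient is the tree's generalised Dirichlet series
`W(τ_x g ⋆ g̃) = ∑_σ m(σ) ĝ(σ) conj ĝ(1-σ̄) e^{(σ-1/2)x} = WeilConverse.expSum g x`, whose Laplace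
transform has a genuine pole at `ρ - 1/2` for every zero with `Re ρ > 1/2` and a narrow bump `g`
(`stub_zeroDetector`)
⟹ at most `κ` zeros with `1/2 < Re ρ < 1`; by `ρ ↦ 1 - ρ` (LANDED Negative lemma
`Negative.cofiniteCriticalLine_iff_rightHalf_finite`, Theorems/CofiniteCriticalLine/Negative/Reformulations.lean)
the crux.

Composition kernel-checked below: `rightHalf_finite_of` takes the five stub STATEMENTS as
hypotheses and concludes `{ζ = 0, 1/2 < Re < 1}.Finite` (no `sorry`; axioms propext /
Classical.choice / Quot.sound); `CofiniteCriticalLine_of` is the hypothesis-free skeleton theorem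
(the A12 audit shape, the only theorem concluding the crux decl): it concludes
`RuelleBand.CofiniteCriticalLine` by name and its only `sorryAx` comes through the five registered
`stub_*` constants.

Disproof / Negative lemmas honoured (imported and elaborated against): `Negative.cofiniteCriticalLine_false_without_neHalf`
(Hardy: on-line zeros are unimodular spectrum of `U_1` and are never counted — only `Re ρ > 1/2` is
detected, stub 5, and the count `≤ κ` comes from NEUTRALITY, stub 3); `_false_without_rePos`,
`_false_without_zeta` (stub 5 quantifies over zeros of `ζ` with `1/2 < Re ρ < 1`);
`Negative.not_abstract_asymptotic_imp_cofinite` (the line does not pass through rung #4: with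
`κ = ∞` or with "unitary + compact" = route item `BandEngine` the expanding spectrum is only
discrete, never finite — ObstructionsR1K3 B1, PinningCensusPontryagin P2);
`Negative.not_cofinite_shape_davenportHeilbronn` (the Euler product enters only through
`explicit_formula_holds`, used in stub 5, and through whatever proves the bet).

Gen-2 deltas w.r.t. gen 1 (same five-stub cut, same stub names): tree `weilTranslate`
(`WeilMellinBounds`) instead of a local duplicate; landed `Negative.Reformulations` (Theorems/, stable)
instead of the `Disproof.lean` workfile; the detector consumes DIAGONAL coefficients only
(`weilMatrixCoeff g g`, = `WeilConverse.expSum g` by the explicit formula; off-diagonal ones are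
recovered by polarisation and are not needed).
-/

noncomputable section

open Complex Set MeasureTheory
open scoped BigOperators ComplexConjugate InnerProductSpace

namespace Summit.RiemannHypothesis.RiemannHypothesis.Cruxes.CofiniteCriticalLine.PontryaginNeutralEngine

open Summit.RiemannHypothesis.RiemannHypothesis.Theses.RuelleBand
open Literature.NumberTheory.LFunctions

/-! ## §1 The pinned form: Weil's quadratic functional and its negative index of inertia -/

/-- The Weil form `Re Q`, `Q(g) = W(g ⋆ g̃)` (`weilQuadratic`; real by `weilQuadratic_im`), has
negative index of inertia `≤ N` on the smooth compactly supported test functions: no `(N+1)`-tuple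
spans a subspace on which `Re Q` is negative definite (a dependent tuple is handled by `c ≠ 0` with
`∑ cᵢ gᵢ = 0`, `Q(0) = 0`). VERBATIM the typing of the sibling cards (SketchIdeator2.lean
`Ideator2.WeilIndexLE`), so that the bet below is literally shared. `N = 0` is `WeilPositivity`. -/
def WeilIndexLE (N : ℕ) : Prop :=
  ∀ g : Fin (N + 1) → ℝ → ℂ, (∀ i, IsWeilTest (g i)) →
    ∃ c : Fin (N + 1) → ℂ, c ≠ 0 ∧ 0 ≤ (weilQuadratic (fun t => ∑ i, c i * g i t)).re

/-- THE BET (`stub_weilIndexBounded`): Weil's form has finitely many negative squares (is of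
Pontryagin type; classical name: the Weil distribution has `κ < ∞` negative squares, Kreĭn–Langer
class `𝔓_κ`). Crux-strength, declared: `⟸ crux` is Bombieri 2000 Thm 8 (index = ½ · #off-line zeros;
the sibling's `IndexCalibration`), `⟹ crux` is THIS line (and, by negative Gram matrices, the
sibling's `IndexEngine`). VERBATIM `Ideator2.BoundedWeilIndex`. -/
def BoundedWeilIndex : Prop := ∃ N : ℕ, WeilIndexLE N

/-- The Weil MATRIX COEFFICIENT `M_{g,h}(x) := W(τ_x g ⋆ h̃)`: the sesquilinear Weil form of the
translate `τ_x g` (tree `weilTranslate g x = fun t ↦ g (t - x)`, `WeilMellinBounds`) against `h`.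
Geometric side: pole + prime sum + archimedean term of the test function `τ_x g ⋆ h̃`; spectral side
(explicit formula, `(τ_x g)^(s) = e^{(s-1/2)x} ĝ(s)` by `weilMellin_weilTranslate`,
`(h̃)^(s) = conj ĥ(1 - s̄)` by `weilMellin_weilReflect_holds`):
`∑_σ m(σ) ĝ(σ) conj ĥ(1 - σ̄) e^{(σ-1/2)x}`; on the diagonal `g = h` this is the tree's
`WeilConverse.expSum g x`. Sesquilinear in `(g, h)`, so the diagonal determines it (polarisation). -/
def weilMatrixCoeff (g h : ℝ → ℂ) (x : ℝ) : ℂ :=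
  weilFunctional (weilConv (weilTranslate g x) (weilReflect h))

/-- Sanity (the definition degenerates correctly): at `x = 0` the diagonal matrix coefficient is
Weil's quadratic functional `Q(g) = W(g ⋆ g̃)`. -/
theorem weilMatrixCoeff_self_zero (g : ℝ → ℂ) : weilMatrixCoeff g g 0 = weilQuadratic g := by
  have h : weilTranslate g 0 = g := funext fun t => by simp [weilTranslate]
  simp [weilMatrixCoeff, weilQuadratic, h]

/-! ## §2 Pontryagin-space data over Mathlib (no Kreĭn-space library exists)

A Pontryagin space `Π_κ` is presented as a complex Hilbert space `H` with a FUNDAMENTAL SYMMETRY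
`J` (self-adjoint, `J² = 1`) whose `-1`-eigenspace `range (1 - J)` is finite-dimensional
(`κ := finrank (range (1 - J))`); the indefinite inner product is `[f, g] = ⟪f, J g⟫`. A one-parameter
group `U` is `J`-UNITARY if `U(x)† J U(x) = J`. Same typing as the sibling's
`Ideator2.PontryaginRealisation`, plus strong continuity (needed for Laplace transforms and for the
local norm bound `sup_{[0,1]} ‖U(x)‖ < ∞`). -/

/-- `(H, J, U)`: fundamental symmetry `J` of finite negative rank and a strongly continuous
one-parameter group `U` of `J`-unitary bounded operators. -/
def IsPontryaginGroup (H : Type) [NormedAddCommGroup H] [InnerProductSpace ℂ H] [CompleteSpace H]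
    (J : H →L[ℂ] H) (U : ℝ → H →L[ℂ] H) : Prop :=
  IsSelfAdjoint J ∧ J.comp J = ContinuousLinearMap.id ℂ H ∧
    FiniteDimensional ℂ
      (LinearMap.range ((ContinuousLinearMap.id ℂ H - J : H →L[ℂ] H) : H →ₗ[ℂ] H)) ∧
    U 0 = ContinuousLinearMap.id ℂ H ∧ (∀ s t : ℝ, U (s + t) = (U s).comp (U t)) ∧
    (∀ x : ℝ, (ContinuousLinearMap.adjoint (U x)).comp (J.comp (U x)) = J) ∧
    (∀ f : H, Continuous fun x : ℝ => U x f)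

/-- Junk check (typing is satisfiable and degenerates correctly): the trivial group on the
Hilbert space `ℂ` with `J = 1` (`κ = 0`, a `Π_0` = Hilbert space) is a Pontryagin group. -/
theorem isPontryaginGroup_trivial :
    IsPontryaginGroup ℂ (ContinuousLinearMap.id ℂ ℂ) (fun _ => ContinuousLinearMap.id ℂ ℂ) := by
  refine ⟨?_, ?_, ?_, rfl, ?_, ?_, ?_⟩
  · exact IsSelfAdjoint.one (ℂ →L[ℂ] ℂ)
  · rfl
  · infer_instance
  · intro s t; rfl
  · intro x
    show (ContinuousLinearMap.adjoint (ContinuousLinearMap.id ℂ ℂ)).comp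
        ((ContinuousLinearMap.id ℂ ℂ).comp (ContinuousLinearMap.id ℂ ℂ)) = ContinuousLinearMap.id ℂ ℂ
    rw [ContinuousLinearMap.adjoint_id]
    rfl
  · intro f
    exact continuous_const

/-- "The complement of `P` is sub-exponential for the semigroup `x ≥ 0`":
`‖U(x) (1 - P)‖ ≤ C_ε e^{εx}` for every `ε > 0`. (For the Riesz projection `P` of `U(1)` onto the
part of the spectrum outside the closed unit disc this is Gelfand's spectral-radius formula plus
`sup_{[0,1]} ‖U(x)‖ < ∞`.) -/
def SubexpComplement (H : Type) [NormedAddCommGroup H] [InnerProductSpace ℂ H] [CompleteSpace H]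
    (U : ℝ → H →L[ℂ] H) (P : H →L[ℂ] H) : Prop :=
  ∀ ε : ℝ, 0 < ε → ∃ C : ℝ, ∀ x : ℝ, 0 ≤ x →
    ‖(U x).comp (ContinuousLinearMap.id ℂ H - P)‖ ≤ C * Real.exp (ε * x)

/-- `F : ℝ → ℂ` HAS A LAPLACE CONTINUATION OFF `Z`: its Laplace transform `∫₀^∞ F(x) e^{-sx} dx`,
taken on some right half-plane `Re s > ω₀`, is the restriction of a function holomorphic on the
open right half-plane minus the finite set `Z`. -/
def HasLaplaceContinuation (Z : Finset ℂ) (F : ℝ → ℂ) : Prop :=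
  ∃ (ω₀ : ℝ) (Φ : ℂ → ℂ), DifferentiableOn ℂ Φ ({s : ℂ | 0 < s.re} \ (↑Z : Set ℂ)) ∧
    ∀ s : ℂ, ω₀ < s.re → Φ s = ∫ x in Ioi (0 : ℝ), F x * cexp (-(s * (x : ℂ)))

/-! ## §3 The statements of the line -/

/-- REALISATION FROM THE PINNED FORM (landing type of `stub_weilPontryaginCompletion`): there is a
Pontryagin group `(H, J, U)` whose matrix coefficients contain all Weil matrix coefficients:
for test `g, h` there are `f₁, f₂ ∈ H` with `⟪f₂, J U(x) f₁⟫ = W(τ_x g ⋆ h̃)` for all real `x`.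
Intended witness: `H = N ⊕ completion(N^⊥)` for a maximal `Q`-negative-definite `N` chosen INSIDE
(test functions ⧸ `Q`-radical) — `N^⊥` is pre-Hilbert by maximality + Cauchy–Schwarz —
`J = (-1) ⊕ 1`, `U(x)` = continuous extension of `[g] ↦ [τ_x g]` (EXACTLY `Q`-isometric:
`τ_x g ⋆ (τ_x h)~ = g ⋆ h̃`), `f₁ = [g]`, `f₂ = [h]`. `H = 0` is no vacuous witness (the clause
would force `W(τ_x g ⋆ h̃) ≡ 0`). -/
def WeilPontryaginRealisation : Prop :=
  ∃ (H : Type) (_ : NormedAddCommGroup H) (_ : InnerProductSpace ℂ H) (_ : CompleteSpace H)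
    (J : H →L[ℂ] H) (U : ℝ → H →L[ℂ] H), IsPontryaginGroup H J U ∧
    ∀ g h : ℝ → ℂ, IsWeilTest g → IsWeilTest h →
      ∃ f₁ f₂ : H, ∀ x : ℝ, ⟪f₂, J (U x f₁)⟫_ℂ = weilMatrixCoeff g h x

/-- THE `Π_κ` ENGINE, structural half (landing type of `stub_pontryaginExpandingPart`): for a
Pontryagin group there is a bounded idempotent `P` commuting with the group, of rank at most
`κ = finrank (range (1 - J))`, off which the semigroup `x ≥ 0` is sub-exponential. Intended `P`:
the Riesz projection of `T = U(1)` for `σ(T) ∩ {|μ| > 1}` — `T†JT = J` with `J = 1 - 2P₋`,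
`rank P₋ = κ` gives `T†T = 1 + finite rank`, so (polar decomposition, `T` invertible) `T` is
unitary + finite rank and that part of the spectrum is isolated eigenvalues of finite multiplicity
(analytic Fredholm, tree `analytic_fredholm_holds` / `spectrum_add_compact_isolated_eigenvalues`);
the span `E` of their root spaces is `J`-NEUTRAL (`[f, g] = [T^{-n} f, T^{-n} g] → 0`) and
`P₋` is injective on a neutral subspace, so `dim E ≤ κ` — this is where finite index is used;
the complement has spectral radius `≤ 1` (Gelfand) and `sup_{[0,1]} ‖U(x)‖ < ∞` (Banach–Steinhaus). -/
def PontryaginExpandingPart : Prop :=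
  ∀ (H : Type) [NormedAddCommGroup H] [InnerProductSpace ℂ H] [CompleteSpace H]
    (J : H →L[ℂ] H) (U : ℝ → H →L[ℂ] H), IsPontryaginGroup H J U →
    ∃ P : H →L[ℂ] H, P.comp P = P ∧ (∀ x : ℝ, P.comp (U x) = (U x).comp P) ∧
      FiniteDimensional ℂ (LinearMap.range (P : H →ₗ[ℂ] H)) ∧
      Module.finrank ℂ (LinearMap.range (P : H →ₗ[ℂ] H)) ≤
        Module.finrank ℂ
          (LinearMap.range ((ContinuousLinearMap.id ℂ H - J : H →L[ℂ] H) : H →ₗ[ℂ] H)) ∧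
      SubexpComplement H U P

/-- THE ENGINE, analytic half (landing type of `stub_laplaceContinuation`; no indefinite structure
needed): if a strongly continuous group `U` commutes with an idempotent `P` of finite rank `r` off
which it is sub-exponential, then ALL matrix coefficients `x ↦ ⟪f₂, J U(x) f₁⟫` (`J` any bounded
operator) have Laplace transforms continuing analytically to `{Re s > 0} ∖ Z` for ONE finite set
`Z` with `#Z ≤ r`. Intended proof: on `range P` the group is `e^{xB}` (tree
`NormContinuousGroup.exists_eq_exp_smul_of_continuous`), contributing the rational function
`⟪f₂, J (s - B)⁻¹ P f₁⟫` with poles in `Z := σ(B)` (`Module.End.finite_spectrum`); the complement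
contributes an absolutely convergent Laplace integral, holomorphic on `Re s > ε` for every `ε > 0`.
`P = 0` degenerates correctly (`Z = ∅`). -/
def LaplaceContinuation : Prop :=
  ∀ (H : Type) [NormedAddCommGroup H] [InnerProductSpace ℂ H] [CompleteSpace H]
    (U : ℝ → H →L[ℂ] H), U 0 = ContinuousLinearMap.id ℂ H →
    (∀ s t : ℝ, U (s + t) = (U s).comp (U t)) → (∀ f : H, Continuous fun x : ℝ => U x f) →
    ∀ P : H →L[ℂ] H, P.comp P = P → (∀ x : ℝ, P.comp (U x) = (U x).comp P) →
      FiniteDimensional ℂ (LinearMap.range (P : H →ₗ[ℂ] H)) → SubexpComplement H U P →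
      ∃ Z : Finset ℂ, Z.card ≤ Module.finrank ℂ (LinearMap.range (P : H →ₗ[ℂ] H)) ∧
        ∀ (J : H →L[ℂ] H) (f₁ f₂ : H), HasLaplaceContinuation Z (fun x => ⟪f₂, J (U x f₁)⟫_ℂ)

/-- THE ZERO DETECTOR (landing type of `stub_zeroDetector`; explicit formula + Laplace transform +
identity theorem, the method of the tree's `BoundedPowerSum` / `WeilCriterionConverse`): if for ALL
test `g` the DIAGONAL Weil matrix coefficient `x ↦ W(τ_x g ⋆ g̃)` has a Laplace continuation off
the finite set `Z`, then every zero `ρ` of `ζ` with `1/2 < Re ρ < 1` has `ρ - 1/2 ∈ Z`. Reason: by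
`explicit_formula_holds` (limits are unique, `WeilConverse.summable_expSum`),
`W(τ_x g ⋆ g̃) = WeilConverse.expSum g x = ∑_σ m(σ) P_g(σ) e^{(σ - 1/2)x}`, whose Laplace transform
`∑_σ m(σ) P_g(σ) / (s - (σ - 1/2))` (`Re s > 1/2`, Fubini) is meromorphic on `ℂ` with simple poles
only at the closed discrete set `{σ - 1/2}` and residue `m(ρ) P_g(ρ) = m(ρ) ĝ(ρ) conj ĝ(1 - ρ̄)`
at `ρ - 1/2`; for the narrow bump of `exists_isWeilTest_re_weilMellin_pos ρ.im` both factors have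
positive real part (same ordinate), so no holomorphic `Φ` through `ρ - 1/2` agrees with it on
`Re s ≫ 1` (identity theorem on `{Re s > 0} ∖ (Z ∪ {σ - 1/2})`, connected) unless `ρ - 1/2 ∈ Z`.
`Z = ∅` reads "no Laplace-entire diagonal Weil coefficients unless no zeros right of the line",
consistent with `WeilConverse.order_mul_pairCoeff_eq_zero`. -/
def ZeroDetector : Prop :=
  ∀ (Z : Finset ℂ) (ρ : ℂ), riemannZeta ρ = 0 → 1 / 2 < ρ.re → ρ.re < 1 →
    (∀ g : ℝ → ℂ, IsWeilTest g → HasLaplaceContinuation Z (weilMatrixCoeff g g)) →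
    ρ - 1 / 2 ∈ Z

/-! ## §4 Registered stubs -/

/-- STUB 1 — THE BET (crux-strength, research content; shared decl-for-decl with the sibling cards
weil-inertia-pontryagin-index (`UniformWindowIndex` ⟺ this, one window per tuple) and
cofinite-weil-index-staircase (END ⟹ this by the crossing lemma)): Weil's quadratic form has
finitely many negative squares. -/
theorem stub_weilIndexBounded : BoundedWeilIndex := by
  sorry

/-- STUB 2 — WEIL–PONTRYAGIN COMPLETION (size L; Iohvidov–Kreĭn–Langer 1982 §§1–2, Bognár 1974
Ch. IV/IX: completion of a non-degenerate inner-product space with `κ < ∞` negative squares;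
boundedness of the `Q`-isometries `τ_x` via the two fundamental decompositions `(N, N^⊥)`,
`(τ_x N, (τ_x N)^⊥)`; ELEMENTARY local norm bound `‖U(x)‖² ≤ 1 + C·max_j ‖U(-x) n_j‖²` from
`‖v‖² = Q(v) + 2|Q|(v_N)` and `[τ_x v, n_j] = [v, τ_{-x} n_j]`; strong continuity from continuity of
`x ↦ W(τ_x g ⋆ h̃)` for fixed test `g, h` — finite prime sum, polar term, Bombieri's archimedean
integral by dominated convergence). -/
theorem stub_weilPontryaginCompletion : BoundedWeilIndex → WeilPontryaginRealisation := by
  sorry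

/-- STUB 3 — THE `Π_κ` ENGINE, structural half (size L; Pontryagin 1944 / IKL 1982: the
non-unimodular spectrum of a `π`-unitary operator consists of `≤ κ` normal eigenvalues counted with
algebraic multiplicity; here via "J-unitary = unitary + finite rank", analytic Fredholm, neutrality
of the expanding root spaces, Gelfand's formula). -/
theorem stub_pontryaginExpandingPart : PontryaginExpandingPart := by
  sorry

/-- STUB 4 — THE ENGINE, analytic half (size M: finite-dimensional continuous groups are
exponentials; resolvent = Laplace transform; holomorphy of absolutely convergent Laplace integrals
on `Re s > ε` for every `ε > 0`). -/
theorem stub_laplaceContinuation : LaplaceContinuation := by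
  sorry

/-- STUB 5 — THE ZERO DETECTOR (size M/L: `explicit_formula_holds`, `weilMellin_weilTranslate`,
`weilMellin_weilConv_holds`, `weilMellin_weilReflect_holds`, `WeilConverse.summable_expSum` /
`norm_pairCoeff_le`, termwise Laplace evaluation (`BoundedPowerSum.hasSum_mellin` shape), identity
theorem on a half-plane minus a countable closed set, `riemannZetaZeroOrder` positive at zeros). -/
theorem stub_zeroDetector : ZeroDetector := by
  sorry

/-! ## §5 The composition (kernel-checked, no `sorry` of its own): the five stubs prove the crux BY NAME -/

/-- `BoundedWeilIndex → (BoundedWeilIndex → WeilPontryaginRealisation) → PontryaginExpandingPart →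
LaplaceContinuation → ZeroDetector → {ζ = 0, 1/2 < Re < 1}.Finite`: realise, extract the finite
expanding part, continue the Laplace transforms, and detect every zero right of the line inside the
finite set `Z + 1/2`. No `sorry`. -/
theorem rightHalf_finite_of :
    BoundedWeilIndex → (BoundedWeilIndex → WeilPontryaginRealisation) → PontryaginExpandingPart →
      LaplaceContinuation → ZeroDetector →
        {s : ℂ | riemannZeta s = 0 ∧ 1 / 2 < s.re ∧ s.re < 1}.Finite := by
  intro hbet hreal hexp hlap hdet
  obtain ⟨H, _, _, _, J, U, hPG, hcoef⟩ := hreal hbet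
  obtain ⟨P, hPP, hPU, hPfin, -, hsub⟩ := hexp H J U hPG
  obtain ⟨-, -, -, hU0, hUadd, -, hcont⟩ := hPG
  obtain ⟨Z, -, hZ⟩ := hlap H U hU0 hUadd hcont P hPP hPU hPfin hsub
  refine ((Z.finite_toSet).image fun z : ℂ => z + 1 / 2).subset ?_
  rintro ρ ⟨hz, h1, h2⟩
  have hmem : ρ - 1 / 2 ∈ Z := by
    refine hdet Z ρ hz h1 h2 fun g hg => ?_
    obtain ⟨f₁, f₂, hf⟩ := hcoef g g hg hg
    have hfun : (fun x : ℝ => ⟪f₂, J (U x f₁)⟫_ℂ) = weilMatrixCoeff g g := funext hf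
    simpa only [hfun] using hZ J f₁ f₂
  exact ⟨ρ - 1 / 2, Finset.mem_coe.2 hmem, by ring⟩

/-- THE SKELETON THEOREM (A12 shape; the ONLY theorem in this file whose conclusion is the crux decl,
so that `#h21_check_skeleton` reads it): the crux `RuelleBand.CofiniteCriticalLine` BY NAME from the
five registered stubs — `rightHalf_finite_of` (sorry-free composition of the five stub STATEMENTS)
followed by the reflection `ρ ↦ 1 - ρ` (landed Negative lemma
`Negative.cofiniteCriticalLine_iff_rightHalf_finite`). Its own body is `sorry`-free; `sorryAx`
enters only through `stub_*`. -/
theorem CofiniteCriticalLine_of :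
    Summit.RiemannHypothesis.RiemannHypothesis.Theses.RuelleBand.CofiniteCriticalLine :=
  Summit.RiemannHypothesis.Cruxes.CofiniteCriticalLine.Negative.cofiniteCriticalLine_iff_rightHalf_finite.2
    (rightHalf_finite_of stub_weilIndexBounded stub_weilPontryaginCompletion
      stub_pontryaginExpandingPart stub_laplaceContinuation stub_zeroDetector)

end Summit.RiemannHypothesis.RiemannHypothesis.Cruxes.CofiniteCriticalLine.PontryaginNeutralEngine

end
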